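import Literature.Geometry.Lorentzian.MinkowskiRadialMultiplier

/-!
# Crux `AdiabaticMultiKerrILED` (line `Sketch`) — pointwise bounds for multiplier currents on flat space

Helper file for the crux `stmt-FinalStateConjecture-14310`
(`Summit.FinalStateConjecture.FinalStateConjecture.Theses.ClusterCompleteness.AdiabaticMultiKerrILED`),
far-field stub `stub_farTransport`, whose currents are computed with the constant Minkowski
coefficients `η = diag(−1, 1, 1, 1)` (`fun _ ↦ Kerr.etaComp`): with `p_μ = ∂_μ w(x)`,
`P = ∑_μ p_μ²`,

* `abs_multiplierCurrent_eta_le` — `|(J^X)^μ| ≤ (3/2) (∑_α |X^α|) P`;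
* `abs_lagrangianCurrent_eta_le` — `|L^μ| ≤ ½ P + ½ ϖ² w² + ½ w² |∂_μ ϖ|`;
* `abs_multiplierBulk_eta_le` — `|K^X| ≤ (3/2) (∑_{μβ} |∂_μ X^β|) P`;
* `abs_etaQ_le` — `|∑ η^{αβ} p_α p_β| ≤ P`; `abs_waveOperator_eta_le` — `|□_η ζ| ≤ ∑_μ |∂_μ∂_μ ζ|`-type
  bound through the operator norm of the Hessian: `|□_η ζ(x)| ≤ 4 ‖D²ζ(x)‖`;
* `abs_fderiv_apply_basisVector_le` — `|∂_μ f| ≤ ‖Df‖`.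
[folklore]
-/

noncomputable section

-- the doubled `FinalStateConjecture.FinalStateConjecture` path component trips dupNamespace
set_option linter.dupNamespace false

open scoped ContDiff Topology
open Filter Set Literature.Geometry.Lorentzian Literature.Geometry.Lorentzian.KerrSchild

namespace Summit.FinalStateConjecture.FinalStateConjecture.Cruxes.AdiabaticMultiKerrILED.Sketch

/-! ### Coordinate partials and operator norms -/

/-- `‖∂_μ‖ = 1` in `E4`. [folklore] -/
theorem norm_basisVector (μ : Fin 4) : ‖E4.basisVector μ‖ = 1 := by
  simp [E4.basisVector]

/-- `|∂_μ f(x)| ≤ ‖Df(x)‖`. [folklore] -/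
theorem abs_fderiv_apply_basisVector_le (f : E4 → ℝ) (x : E4) (μ : Fin 4) :
    |fderiv ℝ f x (E4.basisVector μ)| ≤ ‖fderiv ℝ f x‖ := by
  have h := (fderiv ℝ f x).le_opNorm (E4.basisVector μ)
  rw [norm_basisVector, mul_one, Real.norm_eq_abs] at h
  exact h

/-- `|∂_μ ∂_ν ζ(x)| ≤ ‖D²ζ(x)‖` (second coordinate partial through the iterated Fréchet derivative,
for `ζ` of class `C²` at `x`). [folklore] -/
theorem abs_fderiv_fderiv_apply_le (ζ : E4 → ℝ) (x : E4) (μ ν : Fin 4) :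
    |fderiv ℝ (fderiv ℝ ζ) x (E4.basisVector μ) (E4.basisVector ν)| ≤ ‖fderiv ℝ (fderiv ℝ ζ) x‖ := by
  have h1 := (fderiv ℝ (fderiv ℝ ζ) x (E4.basisVector μ)).le_opNorm (E4.basisVector ν)
  have h2 := (fderiv ℝ (fderiv ℝ ζ) x).le_opNorm (E4.basisVector μ)
  rw [norm_basisVector, mul_one] at h1 h2
  rw [Real.norm_eq_abs] at h1
  exact h1.trans h2

/-! ### Minkowski coefficients -/

/-- `|∑_{αβ} η^{αβ} p_α p_β| ≤ ∑_μ p_μ²`. [folklore] -/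
theorem abs_etaQ_le (p : Fin 4 → ℝ) :
    |∑ α, ∑ β, Kerr.etaComp α β * p α * p β| ≤ ∑ μ, p μ ^ 2 := by
  simp only [etaComp_eq, Fin.sum_univ_four, Fin.isValue]
  simp only [show (1 : Fin 4) ≠ 0 from by decide, show (2 : Fin 4) ≠ 0 from by decide,
    show (3 : Fin 4) ≠ 0 from by decide, show (0 : Fin 4) ≠ 1 from by decide,
    show (0 : Fin 4) ≠ 2 from by decide, show (0 : Fin 4) ≠ 3 from by decide,
    show (1 : Fin 4) ≠ 2 from by decide, show (1 : Fin 4) ≠ 3 from by decide,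
    show (2 : Fin 4) ≠ 1 from by decide, show (2 : Fin 4) ≠ 3 from by decide,
    show (3 : Fin 4) ≠ 1 from by decide, show (3 : Fin 4) ≠ 2 from by decide, if_true, if_false]
  rw [abs_le]
  constructor <;> nlinarith [sq_nonneg (p 0), sq_nonneg (p 1), sq_nonneg (p 2), sq_nonneg (p 3)]

/-- `|∑_ν η^{μν} p_ν| = |p_μ|`. [folklore] -/
theorem abs_sum_etaComp_mul (p : Fin 4 → ℝ) (μ : Fin 4) :
    |∑ ν, Kerr.etaComp μ ν * p ν| = |p μ| := by
  simp only [etaComp_eq, Fin.sum_univ_four, Fin.isValue]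
  fin_cases μ <;> simp

/-! ### The multiplier current -/

/-- **`|(J^X)^μ| ≤ (3/2) (∑_α |X^α|) ∑_μ p_μ²`** for the Minkowski coefficients. [folklore] -/
theorem abs_multiplierCurrent_eta_le :
    ∀ (X : E4 → Fin 4 → ℝ) (w : E4 → ℝ) (x : E4) (μ : Fin 4),
      |KerrSchild.multiplierCurrent (fun _ ↦ Kerr.etaComp) X w x μ| ≤
        3 / 2 * (∑ α, |X x α|) * ∑ κ, (fderiv ℝ w x (E4.basisVector κ)) ^ 2 := by
  intro X w x μ
  obtain ⟨p, hp⟩ : ∃ p : Fin 4 → ℝ, ∀ κ, fderiv ℝ w x (E4.basisVector κ) = p κ := ⟨_, fun _ ↦ rfl⟩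
  simp only [multiplierCurrent, hp]
  set P := ∑ κ, p κ ^ 2 with hP
  have hPnn : 0 ≤ P := Finset.sum_nonneg fun _ _ ↦ sq_nonneg _
  have hpκ : ∀ κ, p κ ^ 2 ≤ P := fun κ ↦
    Finset.single_le_sum (f := fun κ ↦ p κ ^ 2) (fun _ _ ↦ sq_nonneg _) (Finset.mem_univ κ)
  have habsp : ∀ κ, |p κ| ≤ Real.sqrt P := fun κ ↦ by
    rw [← Real.sqrt_sq_eq_abs]; exact Real.sqrt_le_sqrt (hpκ κ)
  -- `|X·p| ≤ (∑|X^α|) √P`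
  have hXp : |∑ α, X x α * p α| ≤ (∑ α, |X x α|) * Real.sqrt P := by
    calc |∑ α, X x α * p α| ≤ ∑ α, |X x α * p α| := Finset.abs_sum_le_sum_abs _ _
      _ = ∑ α, |X x α| * |p α| := by simp_rw [abs_mul]
      _ ≤ ∑ α, |X x α| * Real.sqrt P :=
          Finset.sum_le_sum fun α _ ↦ mul_le_mul_of_nonneg_left (habsp α) (abs_nonneg _)
      _ = (∑ α, |X x α|) * Real.sqrt P := by rw [Finset.sum_mul]
  have hA : |∑ ν, Kerr.etaComp μ ν * p ν| = |p μ| := abs_sum_etaComp_mul p μ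
  have hQ : |∑ α, ∑ β, Kerr.etaComp α β * p α * p β| ≤ P := abs_etaQ_le p
  have hSX : 0 ≤ ∑ α, |X x α| := Finset.sum_nonneg fun _ _ ↦ abs_nonneg _
  have hXμ : |X x μ| ≤ ∑ α, |X x α| :=
    Finset.single_le_sum (f := fun α ↦ |X x α|) (fun _ _ ↦ abs_nonneg _) (Finset.mem_univ μ)
  have hsqrt : Real.sqrt P * Real.sqrt P = P := Real.mul_self_sqrt hPnn
  calc |(∑ ν, Kerr.etaComp μ ν * p ν) * (∑ α, X x α * p α) -
        2⁻¹ * X x μ * ∑ α, ∑ β, Kerr.etaComp α β * p α * p β|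
      ≤ |(∑ ν, Kerr.etaComp μ ν * p ν) * (∑ α, X x α * p α)| +
          |2⁻¹ * X x μ * ∑ α, ∑ β, Kerr.etaComp α β * p α * p β| := abs_sub _ _
    _ = |p μ| * |∑ α, X x α * p α| + 2⁻¹ * |X x μ| * |∑ α, ∑ β, Kerr.etaComp α β * p α * p β| := by
        rw [abs_mul, hA, abs_mul, abs_mul, abs_of_pos (by norm_num : (0 : ℝ) < 2⁻¹)]
    _ ≤ Real.sqrt P * ((∑ α, |X x α|) * Real.sqrt P) + 2⁻¹ * (∑ α, |X x α|) * P := by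
        gcongr
        · exact habsp μ
    _ = 3 / 2 * (∑ α, |X x α|) * P := by
        have : Real.sqrt P * ((∑ α, |X x α|) * Real.sqrt P) = (∑ α, |X x α|) * P := by
          rw [show Real.sqrt P * ((∑ α, |X x α|) * Real.sqrt P) =
            (∑ α, |X x α|) * (Real.sqrt P * Real.sqrt P) by ring, hsqrt]
        rw [this]; ring

/-! ### The Lagrangian current -/

/-- **`|L^μ| ≤ ½ ∑ p² + ½ ϖ² w² + ½ w² |∂_μ ϖ|`** for the Minkowski coefficients. [folklore] -/
theorem abs_lagrangianCurrent_eta_le (ϖ w : E4 → ℝ) (x : E4) (μ : Fin 4) :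
    |lagrangianCurrent (fun _ ↦ Kerr.etaComp) ϖ w x μ| ≤
      2⁻¹ * (∑ κ, (fderiv ℝ w x (E4.basisVector κ)) ^ 2) + 2⁻¹ * (ϖ x ^ 2 * w x ^ 2) +
        2⁻¹ * (w x ^ 2 * |fderiv ℝ ϖ x (E4.basisVector μ)|) := by
  obtain ⟨p, hp⟩ : ∃ p : Fin 4 → ℝ, ∀ κ, fderiv ℝ w x (E4.basisVector κ) = p κ := ⟨_, fun _ ↦ rfl⟩
  obtain ⟨d, hd⟩ : ∃ d : Fin 4 → ℝ, ∀ κ, fderiv ℝ ϖ x (E4.basisVector κ) = d κ := ⟨_, fun _ ↦ rfl⟩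
  simp only [lagrangianCurrent, hp, hd]
  have hA : |∑ ν, Kerr.etaComp μ ν * p ν| = |p μ| := abs_sum_etaComp_mul p μ
  have hB : |∑ ν, Kerr.etaComp μ ν * d ν| = |d μ| := abs_sum_etaComp_mul d μ
  have hpμ : p μ ^ 2 ≤ ∑ κ, p κ ^ 2 :=
    Finset.single_le_sum (f := fun κ ↦ p κ ^ 2) (fun _ _ ↦ sq_nonneg _) (Finset.mem_univ μ)
  calc |ϖ x * w x * ∑ ν, Kerr.etaComp μ ν * p ν - 2⁻¹ * w x ^ 2 * ∑ ν, Kerr.etaComp μ ν * d ν|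
      ≤ |ϖ x * w x * ∑ ν, Kerr.etaComp μ ν * p ν| + |2⁻¹ * w x ^ 2 * ∑ ν, Kerr.etaComp μ ν * d ν| :=
        abs_sub _ _
    _ = |ϖ x| * |w x| * |p μ| + 2⁻¹ * w x ^ 2 * |d μ| := by
        simp only [abs_mul, hA, hB, abs_of_nonneg (sq_nonneg (w x)), abs_inv, abs_two]
    _ ≤ 2⁻¹ * (∑ κ, p κ ^ 2) + 2⁻¹ * (ϖ x ^ 2 * w x ^ 2) + 2⁻¹ * (w x ^ 2 * |d μ|) := by
        have h1 : |ϖ x| * |w x| * |p μ| ≤ 2⁻¹ * (p μ ^ 2) + 2⁻¹ * (ϖ x ^ 2 * w x ^ 2) := by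
          rw [← abs_mul, ← abs_mul]
          have h' : |ϖ x * w x * p μ| ≤ ((ϖ x * w x) ^ 2 + p μ ^ 2) / 2 := by
            rw [abs_le]; constructor <;> nlinarith [sq_nonneg (ϖ x * w x + p μ),
              sq_nonneg (ϖ x * w x - p μ)]
          nlinarith [h']
        nlinarith [h1, hpμ, abs_nonneg (d μ), sq_nonneg (w x)]

/-! ### The bulk term -/

/-- **`|K^X| ≤ (3/2) (∑_{μβ} |∂_μ X^β|) ∑ p²`** for the Minkowski coefficients (`∂η = 0`). [folklore] -/
theorem abs_multiplierBulk_eta_le (X : E4 → Fin 4 → ℝ) (w : E4 → ℝ) (x : E4) :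
    |multiplierBulk (fun _ ↦ Kerr.etaComp) X w x| ≤
      3 / 2 * (∑ μ, ∑ β, |fderiv ℝ (fun y ↦ X y β) x (E4.basisVector μ)|) *
        ∑ κ, (fderiv ℝ w x (E4.basisVector κ)) ^ 2 := by
  obtain ⟨p, hp⟩ : ∃ p : Fin 4 → ℝ, ∀ κ, fderiv ℝ w x (E4.basisVector κ) = p κ := ⟨_, fun _ ↦ rfl⟩
  obtain ⟨D, hD⟩ : ∃ D : Fin 4 → Fin 4 → ℝ,
      ∀ μ β, fderiv ℝ (fun y ↦ X y β) x (E4.basisVector μ) = D μ β := ⟨_, fun _ _ ↦ rfl⟩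
  have hη : ∀ α β : Fin 4, fderiv ℝ (fun _ : E4 ↦ Kerr.etaComp α β) x = 0 := fun α β ↦ by simp
  simp only [multiplierBulk, hp, hD, hη, zero_apply, zero_mul,
    Finset.sum_const_zero, mul_zero, sub_zero]
  set P := ∑ κ, p κ ^ 2 with hP
  set S := ∑ μ, ∑ β, |D μ β| with hS
  have hPnn : 0 ≤ P := Finset.sum_nonneg fun _ _ ↦ sq_nonneg _
  have hpκ : ∀ κ, p κ ^ 2 ≤ P := fun κ ↦
    Finset.single_le_sum (f := fun κ ↦ p κ ^ 2) (fun _ _ ↦ sq_nonneg _) (Finset.mem_univ κ)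
  have habsp : ∀ κ, |p κ| ≤ Real.sqrt P := fun κ ↦ by
    rw [← Real.sqrt_sq_eq_abs]; exact Real.sqrt_le_sqrt (hpκ κ)
  have hsqrt : Real.sqrt P * Real.sqrt P = P := Real.mul_self_sqrt hPnn
  have hA : ∀ μ, |∑ ν, Kerr.etaComp μ ν * p ν| = |p μ| := abs_sum_etaComp_mul p
  have hQ : |∑ α, ∑ β, Kerr.etaComp α β * p α * p β| ≤ P := abs_etaQ_le p
  -- first term
  have h1 : |∑ μ, (∑ ν, Kerr.etaComp μ ν * p ν) * ∑ β, D μ β * p β| ≤ S * P := by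
    calc |∑ μ, (∑ ν, Kerr.etaComp μ ν * p ν) * ∑ β, D μ β * p β|
        ≤ ∑ μ, |(∑ ν, Kerr.etaComp μ ν * p ν) * ∑ β, D μ β * p β| := Finset.abs_sum_le_sum_abs _ _
      _ ≤ ∑ μ, ∑ β, |D μ β| * P := by
          refine Finset.sum_le_sum fun μ _ ↦ ?_
          rw [abs_mul, hA μ]
          calc |p μ| * |∑ β, D μ β * p β| ≤ |p μ| * ∑ β, |D μ β * p β| :=
                mul_le_mul_of_nonneg_left (Finset.abs_sum_le_sum_abs _ _) (abs_nonneg _)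
            _ = ∑ β, |D μ β| * (|p μ| * |p β|) := by
                rw [Finset.mul_sum]; exact Finset.sum_congr rfl fun β _ ↦ by rw [abs_mul]; ring
            _ ≤ ∑ β, |D μ β| * P := Finset.sum_le_sum fun β _ ↦ by
                refine mul_le_mul_of_nonneg_left ?_ (abs_nonneg _)
                calc |p μ| * |p β| ≤ Real.sqrt P * Real.sqrt P :=
                      mul_le_mul (habsp μ) (habsp β) (abs_nonneg _) (Real.sqrt_nonneg _)
                  _ = P := hsqrt
      _ = S * P := by rw [hS, Finset.sum_mul]; exact Finset.sum_congr rfl fun μ _ ↦ by rw [Finset.sum_mul]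
  -- divergence term
  have h2 : |∑ μ, D μ μ| ≤ S := by
    calc |∑ μ, D μ μ| ≤ ∑ μ, |D μ μ| := Finset.abs_sum_le_sum_abs _ _
      _ ≤ ∑ μ, ∑ β, |D μ β| := Finset.sum_le_sum fun μ _ ↦
          Finset.single_le_sum (f := fun β ↦ |D μ β|) (fun _ _ ↦ abs_nonneg _) (Finset.mem_univ μ)
  have hSnn : 0 ≤ S := Finset.sum_nonneg fun _ _ ↦ Finset.sum_nonneg fun _ _ ↦ abs_nonneg _
  calc |(∑ μ, (∑ ν, Kerr.etaComp μ ν * p ν) * ∑ β, D μ β * p β) -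
        2⁻¹ * (∑ μ, D μ μ) * ∑ α, ∑ β, Kerr.etaComp α β * p α * p β|
      ≤ |∑ μ, (∑ ν, Kerr.etaComp μ ν * p ν) * ∑ β, D μ β * p β| +
          |2⁻¹ * (∑ μ, D μ μ) * ∑ α, ∑ β, Kerr.etaComp α β * p α * p β| := abs_sub _ _
    _ ≤ S * P + 2⁻¹ * S * P := by
        rw [abs_mul, abs_mul, abs_of_pos (by norm_num : (0 : ℝ) < 2⁻¹)]
        gcongr
    _ = 3 / 2 * S * P := by ring

/-! ### The flat wave operator through the Hessian -/

/-- **`|□_η ζ(x)| ≤ 4 ‖D²ζ(x)‖`** for `ζ` of class `C²` at `x` (`□_η ζ = ∑_μ η^{μμ} ∂_μ∂_μ ζ`). [folklore] -/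
theorem abs_waveOperator_eta_le {ζ : E4 → ℝ} {x : E4} (hζ : ContDiffAt ℝ 2 ζ x) :
    |waveOperator (fun _ ↦ Kerr.etaComp) ζ x| ≤ 4 * ‖fderiv ℝ (fderiv ℝ ζ) x‖ := by
  -- `∂_μ (∑_ν η^{μν} ∂_ν ζ) = ∑_ν η^{μν} ∂_μ ∂_ν ζ`
  have hd2 : DifferentiableAt ℝ (fderiv ℝ ζ) x :=
    (hζ.fderiv_right (m := 1) le_rfl).differentiableAt one_ne_zero
  have hcoord : ∀ ν, HasFDerivAt (fun y ↦ fderiv ℝ ζ y (E4.basisVector ν))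
      ((fderiv ℝ (fderiv ℝ ζ) x).flip (E4.basisVector ν)) x := fun ν ↦ by
    have h := hd2.hasFDerivAt.clm_apply (hasFDerivAt_const (E4.basisVector ν) x)
    simpa using h
  have hinner : ∀ μ, fderiv ℝ (fun y ↦ ∑ ν, Kerr.etaComp μ ν * fderiv ℝ ζ y (E4.basisVector ν)) x
      (E4.basisVector μ) =
      ∑ ν, Kerr.etaComp μ ν * fderiv ℝ (fderiv ℝ ζ) x (E4.basisVector μ) (E4.basisVector ν) := by
    intro μ
    have h : HasFDerivAt (fun y ↦ ∑ ν, Kerr.etaComp μ ν * fderiv ℝ ζ y (E4.basisVector ν))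
        (∑ ν, Kerr.etaComp μ ν • (fderiv ℝ (fderiv ℝ ζ) x).flip (E4.basisVector ν)) x :=
      HasFDerivAt.fun_sum fun ν _ ↦ (hcoord ν).const_mul (Kerr.etaComp μ ν)
    rw [h.fderiv]
    simp [ContinuousLinearMap.flip_apply]
  unfold waveOperator
  simp only [hinner]
  calc |∑ μ, ∑ ν, Kerr.etaComp μ ν * fderiv ℝ (fderiv ℝ ζ) x (E4.basisVector μ) (E4.basisVector ν)|
      ≤ ∑ μ, |∑ ν, Kerr.etaComp μ ν *
          fderiv ℝ (fderiv ℝ ζ) x (E4.basisVector μ) (E4.basisVector ν)| :=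
        Finset.abs_sum_le_sum_abs _ _
    _ = ∑ μ, |fderiv ℝ (fderiv ℝ ζ) x (E4.basisVector μ) (E4.basisVector μ)| := by
        refine Finset.sum_congr rfl fun μ _ ↦ ?_
        rw [abs_sum_etaComp_mul (fun ν ↦ fderiv ℝ (fderiv ℝ ζ) x (E4.basisVector μ) (E4.basisVector ν))]
    _ ≤ ∑ _μ : Fin 4, ‖fderiv ℝ (fderiv ℝ ζ) x‖ :=
        Finset.sum_le_sum fun μ _ ↦ abs_fderiv_fderiv_apply_le ζ x μ μ
    _ = 4 * ‖fderiv ℝ (fderiv ℝ ζ) x‖ := by simp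

end Summit.FinalStateConjecture.FinalStateConjecture.Cruxes.AdiabaticMultiKerrILED.Sketch

end
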